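import Summits.ResolutionOfSingularities.ResolutionOfSingularities.Theorems.FrobeniusLadderFInjectiveMacaulayficationFCForallExistsCylinder
import Summits.ResolutionOfSingularities.ResolutionOfSingularities.Theorems.FrobeniusLadderFInjectiveMacaulayficationT11OriginPointFixableChar7
import Summits.ResolutionOfSingularities.ResolutionOfSingularities.Theorems.FrobeniusLadderFInjectiveMacaulayficationT11SpecimenDoorGeneric
import HarnessLib

/-!
# FC′ INHABITED AT A SPECIMEN: the body of `FCForallExists` for `X₁ = T₁₁⁺ × 𝔸¹` over every field of characteristic `7`, at the
# generic point of `{0} × 𝔸¹` — UNCONDITIONAL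
# (crux `FInjectiveMacaulayfication` stmt-ResolutionOfSingularities-15315, chain w45a, hole #3γ; res-L1-w45a-plan-1 R13.9 (4); seat res-L1-w45a-stub-3)

[OURS · L1 W4.5a] Support file (`--supports stmt-ResolutionOfSingularities-15315 --as helper`); NOT a statement of any manuscript; no named
fact; AI-written (AI review is weaker than expert review).

`T₁₁⁺ = V(Φ − y² − x³, z² + Φ³ + x¹¹ + w⁷) ⊂ 𝔸⁵_k` (`char k = 7`) is the deciding kill-test specimen of the chain: its origin is an isolated
F-injectivity defect which is POINT-FIXABLE (`T11OriginPointFixableChar7.t11_originPointFixable_char7`, the road-B frame on the kernel-checked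
87-chart toric certificate, moved to the c.i. model by `T11PlusOriginTransportStalk.t11Plus_h0_of_hypersurface_h0`), and every other local ring
satisfies the per-stalk clause (`T11SpecimenDoor.fiClause_atPrime_of_ne_origin`, Fedder + Jacobian). Feeding these two inputs to the cylinder
theorem `FCForallExistsCylinder.fcForallExists_body_cylinder` gives:

* `exists_mk_X_not_mem` — a prime of `k[X]/(Fs)` other than the origin misses some variable;
* `t11Plus_hoff_atPrime_char7` — `hoff` in the shape of the cylinder theorem (all primes `≠` origin);
* `fcForallExists_body_T11plus_cylinder_char7` — **for `X₁ = T₁₁⁺ × 𝔸¹ = Spec (k[x,y,z,w,Φ]/(F₀,F₁))[t]` and `η =` the generic point of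
  `{origin} × 𝔸¹`, the seven conjuncts of the conclusion of `GenericFibreReduction.FCForallExists` hold**: an ideal sheaf `J ≠ ⊥` with
  `η ∈ supp J`, a LocFix datum `c'` at `η` with `J_η = (c')`, and every blowing up along `J` FULL at the non-closed points over
  `supp J ∖ {η}` and Cohen–Macaulay at the closed points over `supp J`. This is the first INHABITED INSTANCE of the v29 door stub
  `stub_fcForallExists` at a specimen of the chain (a calibration rung: the scar is a product line).

No definitions, no named facts. [folklore assembly; the mathematics is the certificate of res-L1-w45a-tri-1 and Fedder's criterion]
-/

-- single-problem summit: the doubled namespace component is forced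
set_option linter.dupNamespace false

noncomputable section

open Polynomial AlgebraicGeometry CategoryTheory Literature.AlgebraicGeometry.Resolution TopologicalSpace IsLocalRing

namespace Summit.ResolutionOfSingularities.ResolutionOfSingularities.Theorems.FInjectiveMacaulayfication.FCForallExistsCylinderT11Char7

open Summit.ResolutionOfSingularities.ResolutionOfSingularities.Theorems.FInjectiveMacaulayfication

variable (k : Type) [Field k]

/-- A prime of `k[X₀,…,X_{n-1}]/(Fs)` different from the origin `(x̄₀,…,x̄_{n-1})` (a maximal ideal when the `Fs` have no constant term)
misses some variable. [folklore] -/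
theorem exists_mk_X_not_mem {n r : ℕ} (Fs : Fin r → MvPolynomial (Fin n) k) (hF : ∀ l, MvPolynomial.constantCoeff (Fs l) = 0)
    (P : Ideal (MvPolynomial (Fin n) k ⧸ Ideal.span (Set.range Fs))) [hP : P.IsPrime]
    (hne : P ≠ Ideal.span (Set.range fun j : Fin n => Ideal.Quotient.mk (Ideal.span (Set.range Fs)) (MvPolynomial.X j))) :
    ∃ j : Fin n, Ideal.Quotient.mk (Ideal.span (Set.range Fs)) (MvPolynomial.X j) ∉ P := by
  by_contra hcon
  push Not at hcon
  apply hne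
  refine ((QuotientOriginMaximal.isMaximal_span_range_mk_X k Fs hF).eq_of_le hP.ne_top ?_).symm
  rw [Ideal.span_le]
  rintro _ ⟨j, rfl⟩
  exact hcon j

/-- **`hoff` for `T₁₁⁺/7` in the cylinder theorem's shape**: at every prime of `k[x,y,z,w,Φ]/(Φ−y²−x³, z²+Φ³+x¹¹+w⁷)` (`char k = 7`) other
than the origin, every system of parameters of the local ring is weakly regular and generates a Frobenius-closed ideal
(`T11SpecimenDoor.fiClause_atPrime_of_ne_origin`). [cite: Fedder1983, Prop. 2.1; Matsumura1987, Thm. 30.4 (ii)] -/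
theorem t11Plus_hoff_atPrime_char7 [CharP k 7] (Fs : Fin 2 → MvPolynomial (Fin 5) k)
    (hF₀ : Fs 0 = MvPolynomial.X 4 - MvPolynomial.X 1 ^ 2 - MvPolynomial.X 0 ^ 3)
    (hF₁ : Fs 1 = MvPolynomial.X 2 ^ 2 + MvPolynomial.X 4 ^ 3 + MvPolynomial.X 0 ^ 11 + MvPolynomial.X 3 ^ 7)
    (y₀ : Spec (.of (MvPolynomial (Fin 5) k ⧸ Ideal.span (Set.range Fs))))
    (hy₀ : y₀.asIdeal = Ideal.span (Set.range fun j : Fin 5 => Ideal.Quotient.mk (Ideal.span (Set.range Fs)) (MvPolynomial.X j))) :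
    ∀ y : Spec (.of (MvPolynomial (Fin 5) k ⧸ Ideal.span (Set.range Fs))), y ≠ y₀ →
      ∀ d : ℕ, ringKrullDim (Localization.AtPrime y.asIdeal) = d →
        ∀ s : Fin d → Localization.AtPrime y.asIdeal, (Ideal.span (Set.range s)).radical.IsMaximal →
          RingTheory.Sequence.IsWeaklyRegular (Localization.AtPrime y.asIdeal) (List.ofFn s) ∧
          ∀ z : Localization.AtPrime y.asIdeal, (∃ e : ℕ, z ^ 7 ^ e ∈ Ideal.span ((fun w : Localization.AtPrime y.asIdeal => w ^ 7 ^ e) ''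
            (Ideal.span (Set.range s) : Set (Localization.AtPrime y.asIdeal)))) → z ∈ Ideal.span (Set.range s) := by
  intro y hy
  have hne : y.asIdeal ≠ Ideal.span (Set.range fun j : Fin 5 => Ideal.Quotient.mk (Ideal.span (Set.range Fs)) (MvPolynomial.X j)) := by
    intro h
    exact hy (PrimeSpectrum.ext (h.trans hy₀.symm))
  exact (T11SpecimenDoor.fiClause_atPrime_of_ne_origin k Fs hF₀ hF₁ y.asIdeal
    (exists_mk_X_not_mem k Fs (T11SpecimenDoorGeneric.constantCoeff_eq_zero Fs hF₀ hF₁) y.asIdeal hne)).2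

/-- **FC′ INHABITED AT `T₁₁⁺ × 𝔸¹` OVER EVERY FIELD OF CHARACTERISTIC `7` — UNCONDITIONAL.** For `R = k[x,y,z,w,Φ]/(Φ−y²−x³, z²+Φ³+x¹¹+w⁷)`,
`char k = 7`, `X₁ = Spec R[t] = T₁₁⁺ × 𝔸¹`, `y₀ =` the origin of `Spec R` and `η = 𝔪_{y₀}·R[t]` (the generic point of `{y₀} × 𝔸¹`): the seven
conjuncts of the conclusion of the v29 door stub `GenericFibreReduction.FCForallExists` hold at `(X₁, η)` — there are an ideal sheaf `J ≠ ⊥` on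
`X₁` with `η ∈ supp J` and a LocFix datum `c'` at `η` (`(c') ≠ 0`, `(c') ≤ 𝔪_η`, every chart of `Bl_{(c')} Spec 𝒪_η` FULL over `𝔪_η`) with
`J_η = (c')`, such that every blowing up `π : X₂ → X₁` along `J` is FULL at the non-closed points over `supp J ∖ {η}` and Cohen–Macaulay at the
closed points over `supp J`. Inputs: `h0` = `t11Plus_h0_of_hypersurface_h0 ∘ t11_originPointFixable_char7` (road B), `hoff` =
`t11Plus_hoff_atPrime_char7`; engine: `FCForallExistsCylinder.fcForallExists_body_cylinder`. Axioms standard; no named fact.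
[OURS · L1 W4.5a; folklore assembly] -/
theorem fcForallExists_body_T11plus_cylinder_char7 [CharP k 7] (Fs : Fin 2 → MvPolynomial (Fin 5) k)
    (hF₀ : Fs 0 = MvPolynomial.X 4 - MvPolynomial.X 1 ^ 2 - MvPolynomial.X 0 ^ 3)
    (hF₁ : Fs 1 = MvPolynomial.X 2 ^ 2 + MvPolynomial.X 4 ^ 3 + MvPolynomial.X 0 ^ 11 + MvPolynomial.X 3 ^ 7)
    (y₀ : Spec (.of (MvPolynomial (Fin 5) k ⧸ Ideal.span (Set.range Fs))))
    (hy₀ : y₀.asIdeal = Ideal.span (Set.range fun j : Fin 5 => Ideal.Quotient.mk (Ideal.span (Set.range Fs)) (MvPolynomial.X j)))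
    (η : Spec (.of (MvPolynomial (Fin 5) k ⧸ Ideal.span (Set.range Fs))[X]))
    (hη : η.asIdeal = y₀.asIdeal.map (C : (MvPolynomial (Fin 5) k ⧸ Ideal.span (Set.range Fs)) →+* (MvPolynomial (Fin 5) k ⧸ Ideal.span (Set.range Fs))[X])) :
    ∃ (J : (Spec (.of (MvPolynomial (Fin 5) k ⧸ Ideal.span (Set.range Fs))[X])).IdealSheafData) (n' : ℕ)
      (c' : Fin n' → (Spec (.of (MvPolynomial (Fin 5) k ⧸ Ideal.span (Set.range Fs))[X])).presheaf.stalk η),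
      J ≠ ⊥ ∧ η ∈ (J.support : Set (Spec (.of (MvPolynomial (Fin 5) k ⧸ Ideal.span (Set.range Fs))[X]))) ∧
      Ideal.span (Set.range c') ≠ ⊥ ∧
      Ideal.span (Set.range c') ≤ maximalIdeal ((Spec (.of (MvPolynomial (Fin 5) k ⧸ Ideal.span (Set.range Fs))[X])).presheaf.stalk η) ∧
      (∀ (j : Fin n') (𝔔 : PrimeSpectrum (blowupAlgebra (Ideal.span (Set.range c')) (c' j))),
        𝔔.asIdeal.comap (algebraMap ((Spec (.of (MvPolynomial (Fin 5) k ⧸ Ideal.span (Set.range Fs))[X])).presheaf.stalk η)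
          (blowupAlgebra (Ideal.span (Set.range c')) (c' j))) =
          maximalIdeal ((Spec (.of (MvPolynomial (Fin 5) k ⧸ Ideal.span (Set.range Fs))[X])).presheaf.stalk η) →
        IsDomain (Localization.AtPrime 𝔔.asIdeal) ∧ ∀ d : ℕ, ringKrullDim (Localization.AtPrime 𝔔.asIdeal) = d →
          ∀ s : Fin d → Localization.AtPrime 𝔔.asIdeal, (Ideal.span (Set.range s)).radical.IsMaximal →
            RingTheory.Sequence.IsWeaklyRegular (Localization.AtPrime 𝔔.asIdeal) (List.ofFn s) ∧
            ∀ y : Localization.AtPrime 𝔔.asIdeal, (∃ e : ℕ, y ^ 7 ^ e ∈ Ideal.span ((fun z : Localization.AtPrime 𝔔.asIdeal => z ^ 7 ^ e) ''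
              (Ideal.span (Set.range s) : Set (Localization.AtPrime 𝔔.asIdeal)))) → y ∈ Ideal.span (Set.range s)) ∧
      stalkIdeal J η = Ideal.span (Set.range c') ∧
      (∀ (X₂ : Scheme.{0}) (π : X₂ ⟶ Spec (.of (MvPolynomial (Fin 5) k ⧸ Ideal.span (Set.range Fs))[X])), IsBlowup π J →
        (∀ x : X₂, π.base x ∈ (J.support : Set (Spec (.of (MvPolynomial (Fin 5) k ⧸ Ideal.span (Set.range Fs))[X]))) → π.base x ≠ η →
          ¬ IsClosed ({x} : Set X₂) →
          IsDomain (X₂.presheaf.stalk x) ∧ ∀ d : ℕ, ringKrullDim (X₂.presheaf.stalk x) = d → ∀ s : Fin d → X₂.presheaf.stalk x,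
            (Ideal.span (Set.range s)).radical.IsMaximal → RingTheory.Sequence.IsWeaklyRegular (X₂.presheaf.stalk x) (List.ofFn s) ∧
            ∀ t : X₂.presheaf.stalk x, (∃ e : ℕ, t ^ 7 ^ e ∈ Ideal.span ((fun z : X₂.presheaf.stalk x => z ^ 7 ^ e) ''
              (Ideal.span (Set.range s) : Set (X₂.presheaf.stalk x)))) → t ∈ Ideal.span (Set.range s)) ∧
        (∀ x : X₂, π.base x ∈ (J.support : Set (Spec (.of (MvPolynomial (Fin 5) k ⧸ Ideal.span (Set.range Fs))[X]))) →
          IsClosed ({x} : Set X₂) →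
          ∀ d : ℕ, ringKrullDim (X₂.presheaf.stalk x) = d → ∀ s : Fin d → X₂.presheaf.stalk x,
            (Ideal.span (Set.range s)).radical.IsMaximal → RingTheory.Sequence.IsWeaklyRegular (X₂.presheaf.stalk x) (List.ofFn s))) := by
  haveI : Fact (Nat.Prime 7) := ⟨by norm_num⟩
  haveI : (Ideal.span (Set.range Fs)).IsPrime := (T11PlusPrime.t11plus_prime_and_X_ne_zero k Fs hF₀ hF₁).1
  haveI : IsDomain (MvPolynomial (Fin 5) k ⧸ Ideal.span (Set.range Fs)) := Ideal.Quotient.isDomain _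
  haveI : CharP (MvPolynomial (Fin 5) k ⧸ Ideal.span (Set.range Fs)) 7 :=
    charP_of_injective_algebraMap (algebraMap k (MvPolynomial (Fin 5) k ⧸ Ideal.span (Set.range Fs))).injective 7
  -- the origin is a closed point
  have hcl : IsClosed ({y₀} : Set (Spec (.of (MvPolynomial (Fin 5) k ⧸ Ideal.span (Set.range Fs))))) := by
    refine (PrimeSpectrum.isClosed_singleton_iff_isMaximal y₀).mpr ?_
    rw [hy₀]
    exact QuotientOriginMaximal.isMaximal_span_range_mk_X k Fs (T11SpecimenDoorGeneric.constantCoeff_eq_zero Fs hF₀ hF₁)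
  -- `h0` at the origin of the c.i. model, from the road-B instance on the hypersurface model
  haveI : (Ideal.span (Set.range fun j : Fin 4 => Ideal.Quotient.mk (Ideal.span (Set.range
      (![MvPolynomial.X 2 ^ 2 + (MvPolynomial.X 1 ^ 2 + MvPolynomial.X 0 ^ 3) ^ 3 + MvPolynomial.X 0 ^ 11 + MvPolynomial.X 3 ^ 7] :
        Fin 1 → MvPolynomial (Fin 4) k))) (MvPolynomial.X j))).IsPrime :=
    (QuotientOriginMaximal.isMaximal_span_range_mk_X k
      (![MvPolynomial.X 2 ^ 2 + (MvPolynomial.X 1 ^ 2 + MvPolynomial.X 0 ^ 3) ^ 3 + MvPolynomial.X 0 ^ 11 + MvPolynomial.X 3 ^ 7] :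
        Fin 1 → MvPolynomial (Fin 4) k)
      (fun l => by fin_cases l; simp [MvPolynomial.constantCoeff_X])).isPrime
  have h0 := T11PlusOriginTransportStalk.t11Plus_h0_of_hypersurface_h0 k 7 Fs hF₀ hF₁
      (![MvPolynomial.X 2 ^ 2 + (MvPolynomial.X 1 ^ 2 + MvPolynomial.X 0 ^ 3) ^ 3 + MvPolynomial.X 0 ^ 11 + MvPolynomial.X 3 ^ 7] :
        Fin 1 → MvPolynomial (Fin 4) k) rfl
      (T11OriginPointFixableChar7.t11_originPointFixable_char7 k _ rfl) y₀ hy₀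
  exact FCForallExistsCylinder.fcForallExists_body_cylinder 7 (MvPolynomial (Fin 5) k ⧸ Ideal.span (Set.range Fs)) y₀ hcl
    (t11Plus_hoff_atPrime_char7 k Fs hF₀ hF₁ y₀ hy₀) h0 η hη

end Summit.ResolutionOfSingularities.ResolutionOfSingularities.Theorems.FInjectiveMacaulayfication.FCForallExistsCylinderT11Char7

end
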